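import Literature.Probability.LatticeModels.DirichletGreenFunction
import HarnessLib

/-!
# First-entrance decomposition of the Dirichlet Green function across a removed set

Stub `stub_greenDecomposition` of line `excursion-domination` of the crux `FKGToTraversalBound`
(stmt-CriticalPhenomena-1878, route `SAWLeftRightFKG`): for finite `Λ, H ⊆ ℤ^d` (`d ≥ 1`), `a ∉ H`
and any `b`,

  `G_Λ(a,b) = G_{Λ∖H}(a,b) + ∑_{z ∈ H} H_{Λ∖H}(a,z) · G_Λ(z,b)`,

where `G_Λ = dirichletGreen Λ` is the Green function of the simple random walk killed on leaving
`Λ` and `H_{Λ'}(a,·) = poissonKernel Λ' a` is the harmonic measure (Poisson kernel) of `Λ' = Λ ∖ H`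
(`Literature/Probability/LatticeModels/DirichletGreenFunction.lean`). This is the matrix form of
the strong Markov property at the first entrance time of `H`: the walk from `a` visits `b` either
before it enters `H`, or it enters `H` first at some `z` and then travels from `z` to `b`.

Proof (`dirichletGreen_eq_sdiff_add_sum`, any `d ≥ 1`): Green's representation formula
`green_representation` in `Λ ∖ H` for `F = G_Λ(·,b) = G_Λ(b,·)` (`dirichletGreen_comm`); the charge
`-Δ F` on `Λ ∖ H ⊆ Λ` is `δ_b` (`neg_latticeLaplacianZd_dirichletGreen`), so the volume term is
`G_{Λ∖H}(a,b)`; in the boundary term the points of `∂(Λ ∖ H)` outside `Λ` do not contribute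
(`G_Λ(z,b) = 0`) and the remaining ones lie in `H`, while a point of `H` off `∂(Λ ∖ H)` carries no
harmonic measure (`poissonKernel_eq_zero_of_not_mem_outerBoundary`). For `a ∉ Λ` every term
vanishes. Corollaries: `0 ≤ G_Λ(a,b) - G_{Λ∖H}(a,b)` and `G_{Λ∖H} ≤ G_Λ` pointwise
(`dirichletGreen_sdiff_nonneg`, `dirichletGreen_sdiff_le`).

Reference: G. F. Lawler, *Intersections of Random Walks* (Birkhäuser 1991), §1.4–1.5 (strong
Markov property for the Green function and harmonic measure of a finite set). Classical; no named
fact is used, axioms are the standard three.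
-/

noncomputable section

open Finset
open Literature.Probability.LatticeModels

namespace Summit.CriticalPhenomena.SAWScalingLimit.Theorems.FKGToTraversalBound.ExcursionDomination

variable {d : ℕ}

/-- The Poisson kernel `H_Λ(x, ·)` is supported on the outer boundary `∂Λ`: if `z ∉ ∂Λ` then
either `z ∈ Λ` (and `H_Λ(x,z) = 0` by definition) or no neighbour of `z` lies in `Λ`, so that
`H_Λ(x,z) = ∑_{w ∼ z} G_Λ(x,w) = 0`. [folklore] -/
theorem poissonKernel_eq_zero_of_not_mem_outerBoundary (Λ : Finset (Site d)) (x : Site d)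
    {z : Site d} (hz : z ∉ outerBoundary (zdGraph d) Λ) : poissonKernel Λ x z = 0 := by
  unfold poissonKernel
  split_ifs with hzΛ
  · rfl
  · refine Finset.sum_eq_zero fun w hw => dirichletGreen_of_not_mem_right Λ x fun hwΛ => hz ?_
    exact mem_outerBoundary_iff.2 ⟨hzΛ, w, hwΛ, (SimpleGraph.mem_neighborFinset _ _ _).1 hw⟩

/-- The Green potential in `Λ'` of the charge `-Δ G_Λ(·, b)`, for `Λ' ⊆ Λ`, is `G_{Λ'}(a, b)`:
`∑_{y ∈ Λ'} G_{Λ'}(a,y) (-Δ G_Λ(·,b))(y) = G_{Λ'}(a,b)` (`-Δ G_Λ(·,b) = δ_b` on `Λ ⊇ Λ'`; both sides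
vanish when `b ∉ Λ'`). [folklore] -/
theorem sum_dirichletGreen_mul_neg_latticeLaplacianZd_dirichletGreen (hd : 0 < d)
    {Λ Λ' : Finset (Site d)} (hΛ' : Λ' ⊆ Λ) (a b : Site d) :
    ∑ y ∈ Λ', dirichletGreen Λ' a y * (-latticeLaplacianZd (fun x => dirichletGreen Λ x b) y) =
      dirichletGreen Λ' a b := by
  have hF : (fun x => dirichletGreen Λ x b) = dirichletGreen Λ b :=
    funext fun x => dirichletGreen_comm Λ x b
  rw [hF, Finset.sum_eq_single b]
  · by_cases hb : b ∈ Λ'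
    · rw [neg_latticeLaplacianZd_dirichletGreen hd Λ b (hΛ' hb), if_pos rfl, mul_one]
    · rw [dirichletGreen_of_not_mem_right Λ' a hb, zero_mul]
  · intro y hy hyb
    rw [neg_latticeLaplacianZd_dirichletGreen hd Λ b (hΛ' hy), if_neg (Ne.symm hyb), mul_zero]
  · intro hb
    rw [dirichletGreen_of_not_mem_right Λ' a hb, zero_mul]

/-- The boundary term of Green's formula in `Λ ∖ H` for `G_Λ(·, b)` is a sum over `H`:
`∑_{z ∈ ∂(Λ∖H)} H_{Λ∖H}(a,z) G_Λ(z,b) = ∑_{z ∈ H} H_{Λ∖H}(a,z) G_Λ(z,b)` — boundary points of `Λ ∖ H`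
outside `H` lie outside `Λ`, where `G_Λ(·, b) = 0`, and points of `H` off `∂(Λ ∖ H)` carry no
harmonic measure. [folklore] -/
theorem sum_outerBoundary_sdiff_poissonKernel_mul (Λ H : Finset (Site d)) (a b : Site d) :
    ∑ z ∈ outerBoundary (zdGraph d) (Λ \ H), poissonKernel (Λ \ H) a z * dirichletGreen Λ z b =
      ∑ z ∈ H, poissonKernel (Λ \ H) a z * dirichletGreen Λ z b := by
  have h1 : ∑ z ∈ outerBoundary (zdGraph d) (Λ \ H), poissonKernel (Λ \ H) a z * dirichletGreen Λ z b =
      ∑ z ∈ outerBoundary (zdGraph d) (Λ \ H) ∪ H,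
        poissonKernel (Λ \ H) a z * dirichletGreen Λ z b := by
    refine Finset.sum_subset Finset.subset_union_left fun z _ hz => ?_
    rw [poissonKernel_eq_zero_of_not_mem_outerBoundary _ a hz, zero_mul]
  have h2 : ∑ z ∈ H, poissonKernel (Λ \ H) a z * dirichletGreen Λ z b =
      ∑ z ∈ outerBoundary (zdGraph d) (Λ \ H) ∪ H,
        poissonKernel (Λ \ H) a z * dirichletGreen Λ z b := by
    refine Finset.sum_subset Finset.subset_union_right fun z hzU hzH => ?_
    have hzB : z ∈ outerBoundary (zdGraph d) (Λ \ H) := (Finset.mem_union.1 hzU).resolve_right hzH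
    have hzΛ : z ∉ Λ := fun h => (mem_outerBoundary_iff.1 hzB).1 (Finset.mem_sdiff.2 ⟨h, hzH⟩)
    rw [dirichletGreen_of_not_mem_left Λ hzΛ b, mul_zero]
  rw [h1, h2]

/-- **First-entrance decomposition of the Dirichlet Green function** (`d ≥ 1`): for finite
`Λ, H ⊆ ℤ^d`, `a ∉ H` and any `b`,
`G_Λ(a,b) = G_{Λ∖H}(a,b) + ∑_{z ∈ H} H_{Λ∖H}(a,z) G_Λ(z,b)` — the strong Markov property of the walk
killed off `Λ` at its first entrance into `H`, in matrix form (Lawler 1991, §1.4–1.5). For `a ∈ Λ`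
this is Green's representation formula in `Λ ∖ H` applied to `G_Λ(·, b)`; for `a ∉ Λ` all terms
vanish. [folklore] -/
theorem dirichletGreen_eq_sdiff_add_sum (hd : 0 < d) (Λ H : Finset (Site d)) {a : Site d}
    (ha : a ∉ H) (b : Site d) :
    dirichletGreen Λ a b = dirichletGreen (Λ \ H) a b +
      ∑ z ∈ H, poissonKernel (Λ \ H) a z * dirichletGreen Λ z b := by
  by_cases haΛ : a ∈ Λ
  · have ha' : a ∈ Λ \ H := Finset.mem_sdiff.2 ⟨haΛ, ha⟩
    have hrep : dirichletGreen Λ a b =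
        ∑ y ∈ Λ \ H, dirichletGreen (Λ \ H) a y *
            (-latticeLaplacianZd (fun x => dirichletGreen Λ x b) y) +
          ∑ z ∈ outerBoundary (zdGraph d) (Λ \ H),
            poissonKernel (Λ \ H) a z * dirichletGreen Λ z b :=
      green_representation hd (Λ \ H) (fun x => dirichletGreen Λ x b) ha'
    rw [hrep, sum_dirichletGreen_mul_neg_latticeLaplacianZd_dirichletGreen hd Finset.sdiff_subset a b,
      sum_outerBoundary_sdiff_poissonKernel_mul]
  · have ha' : a ∉ Λ \ H := fun h => haΛ (Finset.mem_sdiff.1 h).1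
    rw [dirichletGreen_of_not_mem_left Λ haΛ b, dirichletGreen_of_not_mem_left _ ha' b, zero_add]
    refine (Finset.sum_eq_zero fun z _ => ?_).symm
    rw [poissonKernel_of_not_mem_left _ ha' z, zero_mul]

/-- **Stub `stub_greenDecomposition`** of line `excursion-domination` (registered signature, the
body of the line's `GreenDecomposition`, `d = 2`): for finite `Λ, H ⊆ ℤ²`, `a ∉ H` and any `b`,
`G_Λ(a,b) = G_{Λ∖H}(a,b) + ∑_{z ∈ H} H_{Λ∖H}(a,z) G_Λ(z,b)`
(`dirichletGreen_eq_sdiff_add_sum` with `0 < 2`). [folklore] -/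
theorem stub_greenDecomposition :
    ∀ (Λ H : Finset (Site 2)) (a b : Site 2), a ∉ H →
      dirichletGreen Λ a b = dirichletGreen (Λ \ H) a b +
        ∑ z ∈ H, poissonKernel (Λ \ H) a z * dirichletGreen Λ z b :=
  fun Λ H _ b ha => dirichletGreen_eq_sdiff_add_sum two_pos Λ H ha b

/-- The first-entrance correction is nonnegative (`d ≥ 1`): for `a ∉ H`,
`0 ≤ ∑_{z ∈ H} H_{Λ∖H}(a,z) G_Λ(z,b) = G_Λ(a,b) - G_{Λ∖H}(a,b)` (`H ≥ 0`, `G ≥ 0`). [folklore] -/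
theorem dirichletGreen_sdiff_nonneg (hd : 0 < d) (Λ H : Finset (Site d)) (a b : Site d) :
    0 ≤ dirichletGreen Λ a b - dirichletGreen (Λ \ H) a b := by
  by_cases ha : a ∈ H
  · have ha' : a ∉ Λ \ H := fun h => (Finset.mem_sdiff.1 h).2 ha
    rw [dirichletGreen_of_not_mem_left _ ha' b, sub_zero]
    exact dirichletGreen_nonneg hd Λ a b
  · rw [dirichletGreen_eq_sdiff_add_sum hd Λ H ha b, add_sub_cancel_left]
    exact Finset.sum_nonneg fun z _ =>
      mul_nonneg (poissonKernel_nonneg hd _ a z) (dirichletGreen_nonneg hd Λ z b)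

/-- **Monotonicity of the Dirichlet Green function under removal of sites** (`d ≥ 1`):
`G_{Λ∖H}(a,b) ≤ G_Λ(a,b)` for all `a, b` (killing the walk earlier can only decrease the expected
number of visits). [folklore] -/
theorem dirichletGreen_sdiff_le (hd : 0 < d) (Λ H : Finset (Site d)) (a b : Site d) :
    dirichletGreen (Λ \ H) a b ≤ dirichletGreen Λ a b :=
  sub_nonneg.1 (dirichletGreen_sdiff_nonneg hd Λ H a b)

end Summit.CriticalPhenomena.SAWScalingLimit.Theorems.FKGToTraversalBound.ExcursionDomination
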